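import Mathlib.RingTheory.Derivation.Basic
import Mathlib.RingTheory.Ideal.Height
import Mathlib.RingTheory.Ideal.Colon
import Mathlib.RingTheory.Length
import Mathlib.AlgebraicGeometry.Scheme
import Literature.AlgebraicGeometry.Resolution.StrictNormalCrossingsAt
import HarnessLib

/-!
# Giraud's log-Jacobian ideal `J(X, f, E(f))`, its coprincipal part `D(J)` and the colength
# `c(X, f, ξ)` — derivation form, over an arbitrary base (Giraud 1983, 1.1–1.2, 2.1–2.2)

Topic: `Literature/AlgebraicGeometry/Resolution`. J. Giraud, *Forme normale d'une fonction sur une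
surface de caractéristique positive*, Bull. Soc. Math. France 111 (1983) 109–124 [Giraud1983].
Companion of `GiraudFunctionNormalForm.lean` (which types Giraud's `différentiellement libre`,
the pointwise normal form of Prop. 1.5 (ii) and the named fact `Giraud1983Thm24`). This file types
the INVARIANTS of Giraud's §2, i.e. the objects his termination argument (Lemme 2.1.1, Lemme 2.3,
Thm. 2.4) is about, as REAL DEFINITIONS on a commutative (local) ring `O` and `f ∈ O`:

* `derivJacobianIdeal O f` — Giraud's `J(X, f)` (1.1 (2) with `E = ∅`, (4)): "annulateur du
  morphisme `𝒪_X → Ω¹_X, u ↦ u df`", i.e. the content ideal of `df`, generated by the coordinates of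
  `df` in a basis of `Ω¹_X`; rendered Ω-free as the ideal generated by the values `D f` of all
  derivations `D ∈ Der_ℤ(O)` (for `Ω[O⁄ℤ]` projective — every regular local ring essentially of
  finite type over a field of characteristic `p` — the two agree: a functional on `Ω` is a
  derivation). `E(f) = {ξ : df ∈ 𝔪_ξ Ω¹}` (Déf. 1.2 (1)) is `{ξ : derivJacobianIdeal 𝒪_ξ f ≤ 𝔪_ξ}`
  (`derivCriticalSet`).
* `derivCriticalPrimes O f` — the branches of `E(f)` through the point: the height-one primes of
  `O` containing `J(O, f)` (1.3: "`(Spec(𝒪_X/J(X, f, E(f))))_red = E(f)`").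
* `logDerivJacobianIdeal O f` — Giraud's `J(X, f, E(f))` (1.1 (2), 2.2 (1)): the content ideal of
  `df` in `Ω¹_X(log E(f))`, "engendré par les `x_i ∂f/∂x_i` avec `a(i) ≠ 0` et les `∂f/∂x_j` avec
  `a(j) = 0`" (1.1 (3)); rendered as the ideal of values `D f` of the derivations LOGARITHMIC along
  `E(f)`, i.e. preserving every prime of `derivCriticalPrimes O f` (`x ∣ D x` for a local equation
  `x` of a branch).
* `principalHullIdeal J` — Giraud's bidual `B(I)` (2.1 (1)): "le bidual `B(I)` de `I` est un idéal
  inversible"; on a local UFD the smallest principal ideal containing `I` (generated by the gcd);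
  rendered as the intersection of all principal ideals containing `I`.
* `coprincipalPart J` — Giraud's `D(I) = I · B(I)⁻¹` (2.1 (2)), of finite colength; rendered as the
  colon ideal `(I : B(I))`.
* `giraudColength O f` — `c(X, f, ξ) = long(𝒪_{X,ξ}/D(J(X, f, E(f)))𝒪_{X,ξ})` (2.1 (3), 2.2 (2)), in
  `ℕ∞` (`Module.length`).
* `derivCriticalSet X f`, `IsGiraudSingularPoint X f ξ` — scheme level: `E(f)` and the points of
  `Sing(X, df)` (2.2 (3)) at which (*) holds: closed points of `E(f)` where `E(f)` has strict
  normal crossings (Giraud's (*), the tree's `IsStrictNormalCrossingsAt`) and `c ≠ 0`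
  (given (*), `c = 0` iff `J(X, f, E(f))` is invertible at `ξ` iff (**) holds near `ξ`).

Everything is a plain definition over an arbitrary commutative ring / scheme; the statements that
make them Giraud's (finite colength on a two-dimensional regular local ring, generators in
coordinates, behaviour under blowing up) are theorems proved elsewhere
(`Summits/…/Theorems/RadicialJungCleanModelsLogContentIdeal*.lean` render 1.1 (2)–(3), 1.6 (4),
2.5 in this language). No `F`-finiteness (Giraud's standing hypothesis 1.1, `Ω¹_X` of finite rank)
is built into the definitions: that is the point of the derivation form.

This file is definitions only; the sanity lemmas (`J(X,f,E(f)) ⊆ J(X,f)`, `I ⊆ B(I)`,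
`I ⊆ D(I)`, `c = 0 ↔ D(J) = ⊤`, unfolding of `derivCriticalSet`) are one-liners proved next to
their first use. Junk values: for `I = ⊥`, `B(⊥) = ⊥` and `D(⊥) = ⊤` (Giraud defines `B`, `D`
for nonzero ideals only; `df ≠ 0` throughout his §2).
-/

noncomputable section

open IsLocalRing AlgebraicGeometry

universe u

namespace Literature.AlgebraicGeometry.Resolution

section Ring

variable (O : Type u) [CommRing O]

/-- **Giraud's `J(X, f)`, derivation form** (Giraud 1983, 1.1 (2) with `E = ∅`, (4): the content
ideal of `df` in `Ω¹_X`): the ideal of `O` generated by the values `D f` of all derivations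
`D ∈ Der_ℤ(O)`. [cite: Giraud1983, 1.1 (2) and (4)] -/
def derivJacobianIdeal (f : O) : Ideal O :=
  Ideal.span (Set.range fun D : Derivation ℤ O O => D f)

/-- **The branches of `E(f)` at the point** (Giraud 1983, Déf. 1.2 (1) and 1.3:
`E(f) = (Spec 𝒪_X/J(X, f))_red`): the height-one primes of `O` containing `J(O, f)` — for
`O = 𝒪_{X,ξ}` on a regular surface, the generic points of the components of the curve `E(f)`
passing through `ξ`. [cite: Giraud1983, Déf. 1.2 (1)] -/
def derivCriticalPrimes (f : O) : Set (Ideal O) :=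
  {P : Ideal O | P.IsPrime ∧ P.height = 1 ∧ derivJacobianIdeal O f ≤ P}

/-- **Giraud's log-Jacobian ideal `J(X, f, E(f))`, derivation form** (Giraud 1983, 1.1 (2)–(3),
2.2 (1): the content ideal of `df` in `Ω¹_X(log E(f))`, generated in coordinates by the
`x_i ∂f/∂x_i` for the branches `x_i = 0` of `E(f)` and the `∂f/∂x_j` for the other coordinates):
the ideal generated by the values `D f` of the derivations `D ∈ Der_ℤ(O)` which are logarithmic
along `E(f)`, i.e. preserve every prime of `derivCriticalPrimes O f`.
[cite: Giraud1983, 1.1 (2)–(3) and 2.2 (1)] -/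
def logDerivJacobianIdeal (f : O) : Ideal O :=
  Ideal.span {v : O | ∃ D : Derivation ℤ O O,
    (∀ P ∈ derivCriticalPrimes O f, ∀ a ∈ P, D a ∈ P) ∧ D f = v}

variable {O}

/-- **Giraud's bidual `B(I)`** (Giraud 1983, 2.1 (1): "le bidual `B(I)` de `I` est un idéal
inversible"): the intersection of all principal ideals containing `I` — on a local unique
factorisation domain, the principal ideal generated by the greatest common divisor of `I`.
[cite: Giraud1983, 2.1 (1)] -/
def principalHullIdeal (I : Ideal O) : Ideal O :=
  sInf {P : Ideal O | P.IsPrincipal ∧ I ≤ P}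

/-- **Giraud's `D(I) = I · B(I)⁻¹`** (Giraud 1983, 2.1 (2): "`C(I) = 𝒪_X/D(I)` … de longueur
finie"): the colon ideal `(I : B(I))` — for `I = g · I′` with `gcd(I′) = 1` in a domain this is
`I′`. [cite: Giraud1983, 2.1 (2)] -/
def coprincipalPart (I : Ideal O) : Ideal O :=
  Submodule.colon I (principalHullIdeal I : Set O)

variable (O)

/-- **Giraud's colength `c(X, f, ξ)`** (Giraud 1983, 2.1 (3), 2.2 (2):
`c(I, ξ) = long(𝒪_{X,ξ}/D(I)𝒪_{X,ξ})` for `I = J(X, f, E(f))`), as an extended natural number: the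
length of `O/D(J(O, f, E(f)))`. [cite: Giraud1983, 2.1 (3) and 2.2 (2)] -/
def giraudColength (f : O) : ℕ∞ :=
  Module.length O (O ⧸ coprincipalPart (logDerivJacobianIdeal O f))

end Ring

/-! ## Scheme level: `E(f)` and the singular points of `df` -/

section Scheme

/-- **Giraud's `E(f)`** (Giraud 1983, Déf. 1.2 (1): `E(f) = {ξ ∈ X : df ∈ 𝔪_{X,ξ} Ω¹_X}`),
derivation form: the points `ξ` at which every derivation of `𝒪_{X,ξ}` maps the germ of `f` into
`𝔪_ξ`. [cite: Giraud1983, Déf. 1.2 (1)] -/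
def derivCriticalSet (X : Scheme.{u}) (f : Γ(X, ⊤)) : Set X :=
  {ξ : X | derivJacobianIdeal (X.presheaf.stalk ξ) (X.presheaf.germ ⊤ ξ trivial f) ≤
    maximalIdeal (X.presheaf.stalk ξ)}

/-- **The singular points of `df` at which (*) holds** (Giraud 1983, 2.2: (*) "`E(ω)` est un
diviseur à croisements normaux", (**) "(*) et `J(X, ω, E(ω))` est l'idéal d'un diviseur à
croisements normaux", `Sing(X, ω)` = the closed set of dimension zero where (**) fails (2.2 (3))):
a CLOSED point `ξ` of `E(f)` at which `E(f)` has strict normal crossings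
(`IsStrictNormalCrossingsAt`) and `c(X, f, ξ) ≠ 0` — given (*), these are exactly the points of
`Sing(X, df)`, the centres of the blow-ups of Thm. 2.4 once (*) holds everywhere.
[cite: Giraud1983, 2.2 (3) and Thm. 2.4] -/
def IsGiraudSingularPoint (X : Scheme.{u}) (f : Γ(X, ⊤)) (ξ : X) : Prop :=
  IsClosed ({ξ} : Set X) ∧ ξ ∈ derivCriticalSet X f ∧
    IsStrictNormalCrossingsAt X (derivCriticalSet X f) ξ ∧
    giraudColength (X.presheaf.stalk ξ) (X.presheaf.germ ⊤ ξ trivial f) ≠ 0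

end Scheme

end Literature.AlgebraicGeometry.Resolution

end
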